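import Summits.QuantumFields.YangMills.Theorems.BalabanUVNodesN19AtSpineCarriers
import Summits.QuantumFields.YangMills.Theorems.BalabanUVNodesN19SizeByName

/-!
# YM-DAG node N19 AT THE SPINE CARRIERS — the K5 stub `YMDAG.UVSplit.S_N19 SRec Inputs` READ THROUGH KNIT v5: every DAG in-edge of
# row n19 (N14 · N16 · N17 · N18 · N22) and [III] Thm 2 (2.43) AS PRINTED enter BY NAME; what the record must hand is the
# NON-SIZE ledger fields, the identifications, and the pin (seat dag-n19-a gen 3; count-neutral; companion of
# `BalabanUVNodesN19AtSpineCarriers` §4 and `BalabanUVNodesN19SizeByName` §3)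

HONEST FRAMING.  Kernel bookkeeping over hypothesis SHAPES; THEOREMS ONLY; 0 sorry; standard axioms.  NE7 ∕ NE1′ are NOT PRINTED and
NOT PROVED; `SRec` (NODE 00's spine carriers of record) and `Inputs` (module 2's K4 hook `RatesAt`) are PARAMETERS; nothing of
Bałaban's is asserted or instantiated; N19 is NOT discharged; Track A count unmoved.  One finite four-torus at fixed ε — NOT
ℝ⁴ ∕ OS ∕ mass gap ∕ Clay.  The remainder pin is the INTERIM junction of `N19AtSpineCarriers` (referee pin of record: U4′'s
`Summable S.δ` is content-free under it; the ∃δ-edge is the whole content); rev 1 re-cuts `S_N19′` existential in δ.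

WHAT IS PROVED.  `s_N19_of_sizeByNameReading`: if `SRec` pins `S.δ := deltaOfRecord …` and the pair `SRec ∧ Inputs` hands, with every
carrier bundle `S`, the hypothesis package of `N19SizeByName.core_summable_of_ledgerAtSync_sizeByName` VERBATIM at the shell-free
cores — (i) the synchronised ledger predicate `LedgerAtSync` FOR WHATEVER SIZE DATA MEETS THE SIZE CLAUSES (= its non-size fields:
term format, reference ledger, booking, other kinds, rate ordering, `one`; cell NODE O), `0 ≤ S.vol`; (ii) [Balaban1988Convergent]
Thm 2 (2.43) AS PRINTED `B14.Thm2Printed H033 fam L β κ₀` (`0 < β < 1 < L`; ONE family holding both runs) with window letters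
`G ≥ 1`, `Cl ≥ 0`, run offset `K₁`; (iii) node N14's pinned pair `DressedStabilityStrict 𝒯 Λ ∧ PositionalCount (N₀Λ₀^{k−j})`,
`0 ≤ Λ₀ ≤ Λ`, `N₀ ≥ 0`, a decidable mark `dressed` on the rate carriers' domains; (iv) the DISPLAYED identifications (v-A), (v-B)
(vacuum slices at each admissible field point ↔ printed E-terms, aligned, window profile = the booking) and (d) (dressed sub-ledger ↔
N14's births, n14-a's (ℓ1)–(ℓ3)); (v) the in-edges BY NAME — N16 `NE3Shape R C₃ θ₃` + `GaugeDominated`, N18 `NE5`, N22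
`NE9 ∧ FadingMemory`, N17 via node U2's `InjectedRate Cd 0 θc disc` on the box, (T) `LipBackground` + `PolyLipGrowth`, window
memberships — then `YMDAG.UVSplit.S_N19 SRec Inputs` (`s_N19_of_coreEdge` ∘ `core_summable_of_ledgerAtSync_sizeByName`).
-/

set_option autoImplicit false

noncomputable section

open Finset MeasureTheory
open scoped BigOperators

namespace Summit.QuantumFields.YangMills.BalabanUVNodes.N19AtSpineCarriers

open Literature.MathematicalPhysics.QuantumFieldTheory.Balaban1983to89
open T4OutputRate T4RecentScale T4GoodClassBudget T4CauchySum T4TowerRateComposition T4TowerRateDischarge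
open T4EtaRateMin (Readings NE3Shape)
open T4RateLiaison (GaugeDominated)
open Summit.QuantumFields.BalabanUV.T4Continuum.Spine
open Summit.QuantumFields.BalabanUV.T4Continuum.NE1p.DressedRoot (DressedTower DressedStabilityStrict)
open Summit.QuantumFields.YangMills.BalabanUVNodes.N19LedgerLinkSync (LedgerDataSync LedgerAtSync)
open Summit.QuantumFields.YangMills.BalabanUVNodes.N19SizeByName (core_summable_of_ledgerAtSync_sizeByName)
open YMDAG.UVSplit (SpineCarriers SpineRecordPred InputsPred S_N19)

variable {N : ℕ} [NeZero N]

/-- **`S_N19` FOR EVERY SIZE-BY-NAME READING** [bookkeeping]: the pin `S.δ = deltaOfRecord …` and, per carrier bundle pinned by `SRec`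
with `Inputs`, the package (i)–(v) of the module docstring — `LedgerAtSync` for whatever size data meets the size clauses, [III] (2.43)
as printed, N14's pinned pair, the identifications (v-A)(v-B)(d), the in-edges N16 · N17 · N18 · N22 + (T) — give
`YMDAG.UVSplit.S_N19 SRec Inputs`.  Every hypothesis is a SHAPE handed by the (absent) record; NOT NE7. [folklore] -/
theorem s_N19_of_sizeByNameReading (SRec : SpineRecordPred N) (Inputs : InputsPred N)
    (hpin : ∀ (F : T4Continuum.T4Family) (D : YMDAG.UVSplit.Datum F N) (g₀ : ℕ → ℝ) (os : List (T4Continuum.ULoop F))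
      (S : SpineCarriers), SRec F D g₀ os S → letI := S.dec
      S.δ = deltaOfRecord S.l₀ S.vol S.T S.Bad (fun K t τ => S.A K t τ - S.shA K t τ) (fun K t τ => S.B K t τ - S.shB K t τ))
    (hread : ∀ (F : T4Continuum.T4Family) (D : YMDAG.UVSplit.Datum F N) (g₀ : ℕ → ℝ) (os : List (T4Continuum.ULoop F))
      (S : SpineCarriers), SRec F D g₀ os S → Inputs F D g₀ os → letI := S.dec
      ∃ (C : Carriers) (_ : DecidableEq C.Dom) (F' : Type) (ι' X' : Type) (_ : MeasurableSpace ι')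
        (L : LedgerDataSync C F' ι' S.ι) (R : Readings ι' X') (W : Set (ℕ → ℝ)) (EA : Functional C C.BgA)
        (EB : Functional C C.BgB) (κ θ₅ C₅ C₉ ω θc Cd γ C₃ θ₃ Pg : ℝ) (q : ℕ) (Λm : ℕ → ℕ → ℝ)
        (CU : (ℕ → ℝ) → ℕ → ℝ) (g : ℕ → ℕ → ℝ) (uA : ℕ → ι' → C.BgA) (uB : ℕ → ι' → C.BgB)
        (H033 : Flow → ℕ → Prop) (I : Type) (fam : I → B14.Sect2Data) (Lb β : ℝ) (κ₀ : ℕ) (Gv Cl : ℝ) (K₁ : ℕ)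
        (P : Type) (𝒯 : DressedTower P) (Λ Λ₀ N₀ : ℝ) (dressed : C.Dom → Prop) (_ : DecidablePred dressed),
        -- (i) the ledger predicate for whatever size data meets the size clauses (= its non-size fields), and the volume sign
        (∀ (Sz : ℕ → ℝ → S.ι → ℕ → ℝ) (E₀ : ℝ) (m : ℕ) (a : ℝ),
          (∀ K t, |t| ≤ S.l₀ → ∀ τ ∈ S.T K \ S.Bad K t, ∀ v ∈ R.dom, ∀ j ≤ K,
            |∑ X ∈ L.fac K t τ with C.scale X = j,
                (Real.log (Real.exp (EB (fun i => g (K + 1) (i + 1)) (uB K v) X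
                    - EB (fun i => g (K + 1) (i + 1)) L.oneB X))
                  - Real.log (Real.exp (EA (g K) (uA K v) X - EA (g K) L.oneA X)))| ≤ Sz K t τ j) →
          0 ≤ E₀ → 0 < a → a < 1 →
          (∀ K t, |t| ≤ S.l₀ → ∀ τ ∈ S.T K \ S.Bad K t, ∀ j ≤ K,
            Sz K t τ j ≤ S.vol * (E₀ * ((K : ℝ) + 1) ^ m * a ^ (K - j))) →
          LedgerAtSync { L with S := Sz, E₀ := E₀, m := m, a := a } S.l₀ S.vol S.T S.Bad
            (fun K t τ => S.A K t τ - S.shA K t τ) (fun K t τ => S.B K t τ - S.shB K t τ) R EA EB κ g uA uB ω θc θ₅ θ₃) ∧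
        0 ≤ S.vol ∧
        -- (ii) [III] Theorem 2 (2.43) AS PRINTED, window letters, run offset
        B14.Thm2Printed H033 fam Lb β κ₀ ∧ β < 1 ∧ 0 < β ∧ 1 < Lb ∧ 1 ≤ Gv ∧ 0 ≤ Cl ∧
        -- (iii) node N14, the pinned pair
        (DressedStabilityStrict 𝒯 Λ ∧ ∀ p K, (𝒯.B p K).PositionalCount fun j k => N₀ * Λ₀ ^ (k - j)) ∧
        0 ≤ N₀ ∧ 0 ≤ Λ₀ ∧ Λ₀ ≤ Λ ∧
        -- (iv) identifications (v-A), (v-B), (d)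
        (∀ K t, |t| ≤ S.l₀ → ∀ τ ∈ S.T K \ S.Bad K t, ∀ v ∈ R.dom, ∀ j ≤ K, ∃ (i : I) (w : (fam i).Ω) (j' : ℕ),
          (fam i).flow.SatisfiesRG (fam i).K ∧ H033 (fam i).flow (fam i).K ∧ 1 ≤ j' ∧ j' ≤ (fam i).K ∧
          (fam i).K - j' = K - j ∧ (fam i).K ≤ K + K₁ ∧
          (∀ n, 0 ≤ (fam i).gammaVol n w) ∧ (fam i).gammaVol (fam i).K w ≤ S.vol ∧
          (∀ n, n < (fam i).K → n < jlogOf Cl (fam i).K → (fam i).gammaVol n w = 0) ∧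
          (∀ n, n < (fam i).K → jlogOf Cl (fam i).K ≤ n → (fam i).gammaVol n w ≤ S.vol * Gv ^ ((fam i).K - n)) ∧
          |∑ X ∈ (L.fac K t τ).filter (fun X => ¬ dressed X) with C.scale X = j,
              (EA (g K) (uA K v) X - EA (g K) L.oneA X)| ≤ |(fam i).eTerm j' (fam i).K w|) ∧
        (∀ K t, |t| ≤ S.l₀ → ∀ τ ∈ S.T K \ S.Bad K t, ∀ v ∈ R.dom, ∀ j ≤ K, ∃ (i : I) (w : (fam i).Ω) (j' : ℕ),
          (fam i).flow.SatisfiesRG (fam i).K ∧ H033 (fam i).flow (fam i).K ∧ 1 ≤ j' ∧ j' ≤ (fam i).K ∧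
          (fam i).K - j' = K - j ∧ (fam i).K ≤ K + K₁ ∧
          (∀ n, 0 ≤ (fam i).gammaVol n w) ∧ (fam i).gammaVol (fam i).K w ≤ S.vol ∧
          (∀ n, n < (fam i).K → n < jlogOf Cl (fam i).K → (fam i).gammaVol n w = 0) ∧
          (∀ n, n < (fam i).K → jlogOf Cl (fam i).K ≤ n → (fam i).gammaVol n w ≤ S.vol * Gv ^ ((fam i).K - n)) ∧
          |∑ X ∈ (L.fac K t τ).filter (fun X => ¬ dressed X) with C.scale X = j,
              (EB (fun i => g (K + 1) (i + 1)) (uB K v) X - EB (fun i => g (K + 1) (i + 1)) L.oneB X)|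
            ≤ |(fam i).eTerm j' (fam i).K w|) ∧
        (∀ K t, |t| ≤ S.l₀ → ∀ τ ∈ S.T K \ S.Bad K t, ∀ v ∈ R.dom,
          ∃ (pA : P) (βA : C.Dom → (𝒯.B pA K).Birth) (Q : Finset (𝒯.B pA K).Cube) (pB : P) (KB : ℕ)
            (βB : C.Dom → (𝒯.B pB KB).Birth),
          (∀ X ∈ (L.fac K t τ).filter (fun X => dressed X), (𝒯.B pA K).birthScale (βA X) = C.scale X) ∧
          (∀ j, Set.InjOn βA ↑(((L.fac K t τ).filter (fun X => dressed X)).filter fun X => C.scale X = j)) ∧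
          (∀ c ∈ Q, (𝒯.B pA K).cubeScale c = K) ∧ ((Q.card : ℝ) ≤ S.vol) ∧
          (∀ X ∈ (L.fac K t τ).filter (fun X => dressed X), ∃ c ∈ Q, βA X ∈ (𝒯.B pA K).feltAt c) ∧
          (∀ X ∈ (L.fac K t τ).filter (fun X => dressed X), KB - (𝒯.B pB KB).birthScale (βB X) = K - C.scale X) ∧
          (∀ X ∈ (L.fac K t τ).filter (fun X => dressed X),
            |EA (g K) (uA K v) X - EA (g K) L.oneA X| ≤ (𝒯.B pA K).size (βA X) K) ∧
          (∀ X ∈ (L.fac K t τ).filter (fun X => dressed X),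
            |EB (fun i => g (K + 1) (i + 1)) (uB K v) X - EB (fun i => g (K + 1) (i + 1)) L.oneB X|
              ≤ (𝒯.B pB KB).size (βB X) KB)) ∧
        -- (v) the in-edges BY NAME and the bracket (T)
        NE3Shape R C₃ θ₃ ∧ 0 ≤ C₃ ∧ GaugeDominated R uA uB ∧
        NE5 EA EB W κ θ₅ C₅ ∧ 0 ≤ θ₅ ∧ 0 ≤ C₅ ∧
        (NE9 EA W κ Λm ∧ T4OutputRate.FadingMemory C₉ ω Λm) ∧ 0 ≤ ω ∧
        InjectedRate Cd 0 θc (fun K j => T4CouplingMatching.disc (g K) (g (K + 1)) j) ∧ 0 ≤ Cd ∧ 0 ≤ θc ∧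
        (∀ K i, i ≤ K → 0 < g K i ∧ g K i ≤ γ) ∧
        LipBackground EA W κ CU ∧ PolyLipGrowth CU g Pg q ∧ 0 ≤ Pg ∧
        (∀ K, g K ∈ W) ∧ (∀ K, (fun i => g (K + 1) (i + 1)) ∈ W)) :
    S_N19 SRec Inputs := by
  refine s_N19_of_coreEdge SRec Inputs hpin fun F D g₀ os S hS hI => ?_
  letI := S.dec
  obtain ⟨C, _, F', ι', X', _, L, R, W, EA, EB, κ, θ₅, C₅, C₉, ω, θc, Cd, γ, C₃, θ₃, Pg, q, Λm, CU, g, uA, uB,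
    H033, I, fam, Lb, β, κ₀, Gv, Cl, K₁, P, 𝒯, Λ, Λ₀, N₀, dressed, _,
    hL, hvol, h11, hβ1, hβ0, hLb, hGv, hCl, h14, hN₀, hΛ₀, hle, hidA, hidB, hidD,
    h16, hC₃, hgd, h18, hθ₅, hC₅, h22, hω, hinj, hCd, hθc, hbox, hU, hG, hPg, hgA, hgB⟩ := hread F D g₀ os S hS hI
  exact core_summable_of_ledgerAtSync_sizeByName hL hvol H033 fam h11 hβ1 hβ0 hLb hGv hCl K₁ h14 hN₀ hΛ₀ hle dressed hidA
    hidB hidD h16 hC₃ hgd h18 hθ₅ hC₅ h22 hω hinj hCd hθc hbox hU hG hPg hgA hgB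

end Summit.QuantumFields.YangMills.BalabanUVNodes.N19AtSpineCarriers

end
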